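import Summits.QuantumFields.YangMills.Theorems.IR.BlockedActivityWStrongCouplingKR
import HarnessLib

/-!
# Crux `IR` (stmt-QuantumFields-19354), lane B «strong coupling AFTER BLOCKING»: the every-group rows on the SHARP Dobrushin window —
# class W at every radius at ALL large meshes, the COFINAL Uc-mixing meshes on `18·N·|β| < 1`, and the certified digit `(32, 1, a⋆)` on `36·N·|β| ≤ 1`

Helper module for item `stmt-QuantumFields-19354` (`--supports`; it closes nothing), lane `ym-19354-onsetsc-p2` (g5); corollaries of
`blockedActivityClassW_strongCoupling_mesh_sharp` (`Theorems/IR/BlockedActivityWStrongCouplingKR`).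

* `meshRadiusKR_le_uniform` — `meshRadiusKR N β q b n ≤ exp(3072 e² · b⁴ q^{b}) − 1` uniformly on `18N|β| ≤ q` (`n ≥ 1`).
* ★ `blockedActivityClassW_strongCoupling_eventually_sharp` — for every radius `a > 0` and every `q < 1`: class W at radius `a` at ALL large
  meshes, uniformly on `18·N·|β| ≤ q`; `univShellCond_strongCoupling_eventually_sharp` ∕ `typShellCondUKPc_strongCoupling_eventually_sharp` —
  the Uc-mixing meshes are COFINAL on the whole open sharp window `18·N·|β| < 1` (`SU(2)`: tree `|β| < 1/36`, Wilson `β_W < 1/18`; g3: `β_W ≤ 1/216`).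
* `meshRadiusSC_32_le_36`, `blockedActivityClassW_32_radiusKP_36` ∕ `univShellCond_32_strongCoupling_36` — the certified digit of g3 (class W at
  THE NUMBER `a⋆ = radiusKP(1∕3552)` at `(b, n) = (32, 1)`) on the six times wider window `36·N·|β| ≤ 1`.

HONEST FRAMING: a strong-coupling (Dobrushin-uniqueness) calibration; nothing about weak coupling, the onset, a gap or Clay.  No `sorry`;
axioms ⊆ {propext, Classical.choice, Quot.sound}; no instances, no notation.
-/

set_option autoImplicit false

noncomputable section

open MeasureTheory ProbabilityTheory
open Literature.MathematicalPhysics.QuantumLattice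
open Literature.Probability.LatticeModels
open Summit.QuantumFields.YangMills.Cruxes.IR.OnsetFormats (UnivShellCond)
open Summit.QuantumFields.YangMills.Cruxes.IR.OnsetFormatsUc (TypShellCondUKPc typShellCondUKPc_of_univShellCond)

namespace Summit.QuantumFields.YangMills.Cruxes.IR.BlockedActivity

section Rows

variable (G : Type) [Group G] [TopologicalSpace G] [IsTopologicalGroup G] [CompactSpace G] [MeasurableSpace G] [BorelSpace G]
  (r : Literature.MathematicalPhysics.QuantumFieldTheory.LatticeRep G)

/-- The radius tends to `0` along the meshes, uniformly on `18N|β| ≤ q`: `meshRadiusKR N β q b n ≤ exp(3072 e² · b⁴ q^{b}) − 1` (`n ≥ 1`;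
`24N|β| ≤ 4q/3 < 2`). -/
theorem meshRadiusKR_le_uniform {N : ℕ} {β q : ℝ} (hq0 : 0 < q) (hq1 : q < 1) (hβ : 18 * (N : ℝ) * |β| ≤ q) (b : ℕ) {n : ℕ} (hn : 1 ≤ n) :
    meshRadiusKR N β q b n ≤ Real.exp (3072 * Real.exp 2 * ((b : ℝ) ^ 4 * q ^ b)) - 1 := by
  refine sub_le_sub_right (Real.exp_le_exp.2 ?_) 1
  have h24 : 24 * (N : ℝ) * |β| ≤ 2 := by linarith
  have he : Real.exp (24 * N * |β|) ≤ Real.exp 2 := Real.exp_le_exp.2 h24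
  have hq : q ^ (2 * n * b) ≤ q ^ b := pow_le_pow_of_le_one hq0.le hq1.le (by nlinarith)
  have hb4 : 0 ≤ (b : ℝ) ^ 4 := by positivity
  calc 3072 * (b : ℝ) ^ 4 * Real.exp (24 * N * |β|) * q ^ (2 * n * b)
      ≤ 3072 * (b : ℝ) ^ 4 * Real.exp 2 * q ^ b := by gcongr
    _ = 3072 * Real.exp 2 * ((b : ℝ) ^ 4 * q ^ b) := by ring

/-- **For every radius `a > 0` and every rate `q < 1` the class of record holds at ALL large meshes, uniformly on `18·N·|β| ≤ q`** (`n ≥ 1` fixed):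
blocking IMPROVES the activity radius exponentially in the mesh on the whole sharp Dobrushin window. -/
theorem blockedActivityClassW_strongCoupling_eventually_sharp {a q : ℝ} (ha : 0 < a) (hq0 : 0 < q) (hq1 : q < 1) {n : ℕ} (hn : 1 ≤ n) :
    ∃ b₀ : ℕ, 1 ≤ b₀ ∧ ∀ b : ℕ, b₀ ≤ b → ∀ β : ℝ, 18 * (r.N : ℝ) * |β| ≤ q → BlockedActivityClassW r.ρ β b n a := by
  have hlim : Filter.Tendsto (fun b : ℕ => (b : ℝ) ^ 4 * q ^ b) Filter.atTop (nhds 0) :=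
    tendsto_pow_const_mul_const_pow_of_abs_lt_one 4 (by rw [abs_of_nonneg hq0.le]; exact hq1)
  have hcont : Filter.Tendsto (fun t : ℝ => Real.exp (3072 * Real.exp 2 * t) - 1) (nhds 0) (nhds (Real.exp (3072 * Real.exp 2 * 0) - 1)) :=
    ((Real.continuous_exp.comp (continuous_const.mul continuous_id)).sub continuous_const).continuousAt.tendsto
  rw [mul_zero, Real.exp_zero, sub_self] at hcont
  have hev := (hcont.comp hlim).eventually (gt_mem_nhds ha)
  obtain ⟨b₁, hb₁⟩ := Filter.eventually_atTop.1 hev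
  refine ⟨max b₁ 1, le_max_right _ _, fun b hb β hβ => ?_⟩
  have hb1 : 1 ≤ b := (le_max_right _ _).trans hb
  have hmaj : meshRadiusKR r.N β q b n ≤ a :=
    ((meshRadiusKR_le_uniform hq0 hq1 hβ b hn).trans (le_of_lt (hb₁ b ((le_max_left _ _).trans hb))))
  exact blockedActivityClassW_mono G (blockedActivityClassW_strongCoupling_mesh_sharp G r hq0 hq1 hβ hb1 hn) hmaj

/-- **SCALE AXIS, strong end on the sharp window: the universal shell condition at ALL large meshes**, uniformly on `18·N·|β| ≤ q` (`q < 1`):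
for every admissible accuracy `0 < ε ≤ 1` and window `n ≥ 1` there is `b₀ ≥ 1` with `UnivShellCond r.ρ β b n ε` for all `b ≥ b₀`. -/
theorem univShellCond_strongCoupling_eventually_sharp {ε q : ℝ} (hε : 0 < ε) (hε1 : ε ≤ 1) (hq0 : 0 < q) (hq1 : q < 1) {n : ℕ} (hn : 1 ≤ n) :
    ∃ b₀ : ℕ, 1 ≤ b₀ ∧ ∀ b : ℕ, b₀ ≤ b → ∀ β : ℝ, 18 * (r.N : ℝ) * |β| ≤ q → UnivShellCond r.ρ β b n ε := by
  obtain ⟨b₀, hb₀, h⟩ := blockedActivityClassW_strongCoupling_eventually_sharp G r (radiusKP_pos hε) hq0 hq1 hn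
  exact ⟨b₀, hb₀, fun b hb β hβ => univShellCond_of_blockedActivityW_sharp (h b hb β hβ) hε1 le_rfl⟩

/-- **The Uc-mixing meshes are COFINAL on the whole sharp window** `18·N·|β| ≤ q < 1`: format Uc `TypShellCondUKPc r.ρ β b n ε δ` (every `δ`) at
all large meshes (`SU(2)` fundamental: tree `|β| < 1/36`, Wilson `β_W < 1/18`; g3 had `β_W ≤ 1/216`). -/
theorem typShellCondUKPc_strongCoupling_eventually_sharp {ε q : ℝ} (hε : 0 < ε) (hε1 : ε ≤ 1) (hq0 : 0 < q) (hq1 : q < 1) {n : ℕ}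
    (hn : 1 ≤ n) :
    ∃ b₀ : ℕ, 1 ≤ b₀ ∧ ∀ b : ℕ, b₀ ≤ b → ∀ β : ℝ, 18 * (r.N : ℝ) * |β| ≤ q → ∀ δ : ℝ, TypShellCondUKPc r.ρ β b n ε δ := by
  obtain ⟨b₀, hb₀, h⟩ := univShellCond_strongCoupling_eventually_sharp G r hε hε1 hq0 hq1 hn
  exact ⟨b₀, hb₀, fun b hb β hβ δ => typShellCondUKPc_of_univShellCond (h b hb β hβ) δ⟩

/-- The certified digit of g3 on the wider window: at `(b, n) = (32, 1)` and `36·N·|β| ≤ 1` the radius is `≤ 10⁻⁹` (`e^{24N|β|} ≤ e^{2/3} ≤ e`;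
`3072·32⁴·e·2^{−64} ≈ 4.7·10⁻¹⁰`; `e^{t} − 1 ≤ 2t` for `|t| ≤ 1`). -/
theorem meshRadiusSC_32_le_36 {N : ℕ} {β : ℝ} (hβ : 36 * (N : ℝ) * |β| ≤ 1) : meshRadiusSC N β 32 1 ≤ (1 : ℝ) / 10 ^ 9 := by
  set t : ℝ := 3072 * ((32 : ℕ) : ℝ) ^ 4 * Real.exp (24 * N * |β|) * (1 / 2 : ℝ) ^ (2 * 1 * 32) with ht
  have he : Real.exp (24 * N * |β|) ≤ Real.exp 1 := Real.exp_le_exp.2 (by nlinarith [abs_nonneg β, Nat.cast_nonneg (α := ℝ) N])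
  have he1 : Real.exp 1 ≤ 2.7182818286 := Real.exp_one_lt_d9.le
  have ht0 : 0 ≤ t := by positivity
  have htb : t ≤ 1 / (2 * 10 ^ 9) := by
    have : t ≤ 3072 * ((32 : ℕ) : ℝ) ^ 4 * 2.7182818286 * (1 / 2 : ℝ) ^ (2 * 1 * 32) := by
      rw [ht]; gcongr; exact he.trans he1
    refine this.trans ?_
    norm_num
  have habs : |t| ≤ 1 := by rw [abs_of_nonneg ht0]; linarith [htb]
  have hexp : |Real.exp t - 1| ≤ 2 * |t| := Real.abs_exp_sub_one_le habs
  rw [abs_of_nonneg ht0] at hexp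
  have : meshRadiusSC N β 32 1 = Real.exp t - 1 := rfl
  rw [this]
  calc Real.exp t - 1 ≤ |Real.exp t - 1| := le_abs_self _
    _ ≤ 2 * t := hexp
    _ ≤ 1 / 10 ^ 9 := by linarith [htb]

/-- **A hand-over INTO the KP ball AFTER BLOCKING on the window `36·N·|β| ≤ 1`**: class W at THE NUMBER `a⋆ = radiusKP (1∕3552)` at mesh `32`,
window `1`, for every compact `G` and every lattice representation (g3: the same at `216·N·|β| ≤ 1`). -/
theorem blockedActivityClassW_32_radiusKP_36 {β : ℝ} (hβ : 36 * (r.N : ℝ) * |β| ≤ 1) :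
    BlockedActivityClassW r.ρ β 32 1 (radiusKP (1 / 3552)) := by
  refine blockedActivityClassW_mono G (blockedActivityClassW_strongCoupling_mesh_36 G r hβ (by norm_num) le_rfl) ?_
  refine (meshRadiusSC_32_le_36 hβ).trans ?_
  have h := (radiusKP_bounds (ε := 1 / 3552) (by norm_num)).1
  refine le_trans (by norm_num) h.le

/-- … and back through the tree's sharp reduction: `UnivShellCond r.ρ β 32 1 (1∕3552)` on `36·N·|β| ≤ 1`. -/
theorem univShellCond_32_strongCoupling_36 {β : ℝ} (hβ : 36 * (r.N : ℝ) * |β| ≤ 1) :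
    OnsetFormats.UnivShellCond r.ρ β 32 1 (1 / 3552) :=
  univShellCond_of_blockedActivityW_sharp (blockedActivityClassW_32_radiusKP_36 G r hβ) (by norm_num) le_rfl

end Rows

end Summit.QuantumFields.YangMills.Cruxes.IR.BlockedActivity

end
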